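import Summits.BirchSwinnertonDyer.BirchSwinnertonDyer.Theorems.ResidualThetaTransportAtTwoHeckeThetaPartnerAdicAtTwoUnitCharacterPrelim
import Summits.BirchSwinnertonDyer.BirchSwinnertonDyer.Theorems.ResidualThetaTransportAtTwoHeckeThetaPartnerAdicAtTwoMatchingAtTwoPrelim
import Mathlib.NumberTheory.NumberField.Discriminant.Defs
import Mathlib.RingTheory.Ideal.Norm.AbsNorm
import Mathlib.LinearAlgebra.FreeModule.PID
import Mathlib.LinearAlgebra.Matrix.PosDef
import HarnessLib

/-!
# The Gram matrix of an ideal lattice of an imaginary quadratic field (toward K0⁺, stmt-20690)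

Route `ResidualThetaTransportAtTwo`, crux K0⁺ `HeckeThetaPartnerAdicAtTwo` (stmt-BirchSwinnertonDyer-20690),
line "Hecke theta series from the genus-two Riemann theta function" (discharge of the Ribet fact at
weight `2`).  THEOREMS ONLY (no definition, no named fact, no `sorry`).

For an imaginary quadratic field `K` (`[K:ℚ] = 2`, totally complex) with a complex embedding `σ`
and a nonzero ideal `𝔟 ⊆ 𝓞 K`, `exists_gram` produces a `ℤ`-basis `b₀, b₁` of `𝔟` and the Gram
matrix `B ∈ M₂(ℤ)` of the INTEGRAL quadratic form `Q_𝔟(x) = N(x)/N𝔟` on `𝔟` in this basis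
(`B_{ij} = 2 Re(σbᵢ \overline{σbⱼ})/N𝔟`), with: `B` symmetric, even diagonal, `det B = |d_K|`,
positive definite — exactly the hypotheses of the binary-theta files
`Literature/NumberTheory/ModularForms/BinaryTheta*.lean` (`symplEmbed`, theta null law on
`Γ₀(det B) = Γ₀(|d_K|)`).  Classical: Hecke 1926 §2 (the theta series of an ideal class of an
imaginary quadratic field is a binary theta series of discriminant `d_K`); Cox, *Primes of the form
x² + ny²*, Thm. 7.7 (ideals ↔ forms of discriminant `d_K`).

* `absNorm_dvd_natAbs_norm` — `N𝔟 ∣ |N(x)|` for `x ∈ 𝔟`;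
* `normSq_embedding_eq` — `‖σx‖² = |N_{K/ℚ}(x)|` (tree, `HeckeThetaPartner.norm_embedding_sq_eq_abs_norm`);
* `det_embeddings_sq` — `(σb₀·σ̄b₁ - σ̄b₀·σb₁)² = d_K · N𝔟²` for a `ℤ`-basis `b` of `𝔟`
  (Mathlib: `Algebra.discr_eq_det_embeddingsMatrixReindex_pow_two`, `Algebra.discr_of_matrix_vecMul`,
  `Ideal.natAbs_det_basis_change`);
* **`exists_gram`** — the package above.

BSD is not proved by this file.
-/

set_option autoImplicit false
set_option linter.dupNamespace false

noncomputable section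

open scoped NumberField ComplexConjugate
open NumberField Module Matrix Complex

namespace Summit.BirchSwinnertonDyer.BirchSwinnertonDyer.Theorems.HeckeTheta

open Summit.BirchSwinnertonDyer.BirchSwinnertonDyer.Theorems.HeckeThetaPartner

variable {K : Type} [Field K] [NumberField K]

/-! ### Norms of elements of an ideal -/

/-- `N𝔟 ∣ |N(x)|` for `x ∈ 𝔟` (`(x) ⊆ 𝔟`, multiplicativity of the ideal norm). -/
theorem absNorm_dvd_natAbs_norm {𝔟 : Ideal (𝓞 K)} {x : 𝓞 K} (hx : x ∈ 𝔟) :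
    Ideal.absNorm 𝔟 ∣ (Algebra.norm ℤ x).natAbs := by
  rw [← Ideal.absNorm_span_singleton]
  exact Ideal.absNorm_dvd_absNorm_of_le ((Ideal.span_singleton_le_iff_mem _).mpr hx)

/-- `‖σ x‖² = |N(x)|` for an integer `x` of an imaginary quadratic field (real numbers). -/
theorem normSq_embedding_eq (hK : finrank ℚ K = 2) [IsTotallyComplex K] (σ : K →+* ℂ) (x : 𝓞 K) :
    ‖σ (x : K)‖ ^ 2 = ((Algebra.norm ℤ x).natAbs : ℝ) := by
  rw [norm_embedding_sq_eq_abs_norm hK σ (x : K), ← Algebra.coe_norm_int, Nat.cast_natAbs, Int.cast_abs]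
  push_cast
  rfl

/-- Polarization in `ℂ`: `‖u + w‖² - ‖u‖² - ‖w‖² = u·w̄ + ū·w` (as a complex number). -/
private theorem normSq_add_sub (u w : ℂ) :
    ((‖u + w‖ ^ 2 - ‖u‖ ^ 2 - ‖w‖ ^ 2 : ℝ) : ℂ) = u * conj w + conj u * w := by
  have h : ‖u + w‖ ^ 2 - ‖u‖ ^ 2 - ‖w‖ ^ 2 = 2 * (u * conj w).re := by
    rw [Complex.sq_norm, Complex.sq_norm, Complex.sq_norm, Complex.normSq_add]; ring
  rw [h]
  have h2 : conj u * w = conj (u * conj w) := by rw [map_mul, Complex.conj_conj]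
  rw [h2, Complex.add_conj]

/-! ### A `ℤ`-basis of a nonzero ideal indexed by `Fin 2` -/

/-- A nonzero ideal of the ring of integers of a quadratic field has a `ℤ`-basis indexed by `Fin 2`
(Mathlib's `Ideal.selfBasis`, reindexed). -/
theorem exists_basis_fin_two (hK : finrank ℚ K = 2) {𝔟 : Ideal (𝓞 K)} (h𝔟 : 𝔟 ≠ ⊥) :
    ∃ _b : Basis (Fin 2) ℤ 𝔟, True := by
  classical
  have hcard : Fintype.card (Free.ChooseBasisIndex ℤ (𝓞 K)) = 2 := by
    rw [← Module.finrank_eq_card_chooseBasisIndex, RingOfIntegers.rank, hK]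
  exact ⟨(Ideal.selfBasis (RingOfIntegers.basis K) 𝔟 h𝔟).reindex (Fintype.equivFinOfCardEq hcard),
    trivial⟩

/-! ### The discriminant identity `(σb₀ σ̄b₁ - σ̄b₀ σb₁)² = d_K N𝔟²` -/

omit [NumberField K] in
/-- For a totally complex field, `conj ∘ σ ≠ σ` for every complex embedding `σ`. -/
theorem conjugate_ne [IsTotallyComplex K] (σ : K →+* ℂ) : ComplexEmbedding.conjugate σ ≠ σ := by
  intro h
  exact false_of_ringHom_real (ComplexEmbedding.isReal_iff.mpr h).embedding

/-- The two `ℚ`-algebra embeddings of an imaginary quadratic field into `ℂ` are `σ` and `σ̄`: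
every `φ : K →ₐ[ℚ] ℂ` is one of them. -/
theorem algHom_eq_or_eq_conjugate (hK : finrank ℚ K = 2) [IsTotallyComplex K] (σ : K →+* ℂ)
    (φ : K →ₐ[ℚ] ℂ) : (φ : K →+* ℂ) = σ ∨ (φ : K →+* ℂ) = ComplexEmbedding.conjugate σ := by
  classical
  by_contra h
  push Not at h
  -- three distinct ring embeddings in a set of cardinality `2`
  have hcard : Fintype.card (K →+* ℂ) = 2 := by rw [NumberField.Embeddings.card, hK]
  have h3 : Fintype.card (Fin 3) ≤ Fintype.card (K →+* ℂ) := by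
    refine Fintype.card_le_of_injective ![(φ : K →+* ℂ), σ, ComplexEmbedding.conjugate σ] ?_
    intro i j hij
    fin_cases i <;> fin_cases j <;> simp_all [conjugate_ne σ, (conjugate_ne σ).symm]
  simp [hcard] at h3

/-- **`(σb₀·σ̄b₁ - σ̄b₀·σb₁)² = d_K · N𝔟²`** for a `ℤ`-basis `b` of a nonzero ideal `𝔟` of an
imaginary quadratic field: the discriminant of the `ℚ`-basis `b` of `K` is `det(P)² d_K` with
`|det P| = N𝔟` (`Algebra.discr_of_matrix_vecMul`, `Ideal.natAbs_det_basis_change`), and equals the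
square of the determinant of the embeddings matrix (`Algebra.discr_eq_det_embeddingsMatrixReindex_pow_two`). -/
theorem det_embeddings_sq (hK : finrank ℚ K = 2) [IsTotallyComplex K] (σ : K →+* ℂ)
    {𝔟 : Ideal (𝓞 K)} (b : Basis (Fin 2) ℤ 𝔟) :
    (σ ((b 0 : 𝓞 K) : K) * conj (σ ((b 1 : 𝓞 K) : K)) - conj (σ ((b 0 : 𝓞 K) : K)) * σ ((b 1 : 𝓞 K) : K)) ^ 2 =
      ((discr K : ℤ) : ℂ) * ((Ideal.absNorm 𝔟 : ℕ) : ℂ) ^ 2 := by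
  classical
  -- the integral basis of `𝓞 K` indexed by `Fin 2`
  have hcard : Fintype.card (Free.ChooseBasisIndex ℤ (𝓞 K)) = 2 := by
    rw [← Module.finrank_eq_card_chooseBasisIndex, RingOfIntegers.rank, hK]
  set w : Basis (Fin 2) ℤ (𝓞 K) := (RingOfIntegers.basis K).reindex (Fintype.equivFinOfCardEq hcard)
    with hw
  -- the family `v = b` in `K` and the change-of-basis matrix `P`
  set v : Fin 2 → K := fun i => ((b i : 𝓞 K) : K) with hv
  set wK : Fin 2 → K := fun i => ((w i : 𝓞 K) : K) with hwK
  set P : Matrix (Fin 2) (Fin 2) ℤ := w.toMatrix (fun i => (b i : 𝓞 K)) with hP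
  have hPdet : (P.det).natAbs = Ideal.absNorm 𝔟 := by
    rw [hP, ← Basis.det_apply]
    exact Ideal.natAbs_det_basis_change w 𝔟 b
  -- `v = wK ᵥ* P` in `K`
  have hvw : v = wK ᵥ* P.map (algebraMap ℤ K) := by
    funext j
    have h := w.sum_toMatrix_smul_self (v := fun i => (b i : 𝓞 K)) j
    simp only [hv, hwK, Matrix.vecMul, dotProduct, Matrix.map_apply]
    rw [← h]
    push_cast
    simp only [zsmul_eq_mul]
    refine Finset.sum_congr rfl fun i _ => ?_
    rw [hP, mul_comm]
    simp
  -- discriminants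
  have hdw : Algebra.discr ℚ wK = (discr K : ℚ) := by
    have h1 : Algebra.discr ℤ w = discr K := NumberField.discr_eq_discr K w
    have h2 : Algebra.discr ℚ (w.localizationLocalization ℚ (nonZeroDivisors ℤ) K) =
        algebraMap ℤ ℚ (Algebra.discr ℤ w) :=
      Algebra.discr_localizationLocalization ℤ (nonZeroDivisors ℤ) K w
    have h3 : (w.localizationLocalization ℚ (nonZeroDivisors ℤ) K : Fin 2 → K) = wK := by
      funext i
      rw [Basis.localizationLocalization_apply, hwK]
    rw [← h3, h2, h1]
    simp
  have hdv : Algebra.discr ℚ v = (P.det : ℚ) ^ 2 * (discr K : ℚ) := by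
    rw [hvw]
    have hmap : P.map (algebraMap ℤ K) = (P.map (Int.cast : ℤ → ℚ)).map (algebraMap ℚ K) := by
      ext i j; simp
    rw [hmap, Algebra.discr_of_matrix_vecMul, ← hdw]
    congr 1
    rw [show (P.det : ℚ) = (Int.castRingHom ℚ) P.det from rfl, RingHom.map_det]
    rfl
  -- the embeddings matrix for `e = (σ, σ̄)` up to order
  have hcardA : Fintype.card (Fin 2) = finrank ℚ K := by rw [hK]; rfl
  obtain ⟨e⟩ : Nonempty (Fin 2 ≃ (K →ₐ[ℚ] ℂ)) := by
    refine Fintype.card_eq.mp ?_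
    rw [AlgHom.card ℚ K ℂ, hK]; rfl
  have hE := Algebra.discr_eq_det_embeddingsMatrixReindex_pow_two ℚ ℂ v e
  rw [hdv, map_mul, map_pow] at hE
  -- `det² ` of the embeddings matrix, computed through `{e 0, e 1} = {σ, σ̄}`
  have hdet : (Algebra.embeddingsMatrixReindex ℚ ℂ v e).det ^ 2 =
      (σ (v 0) * conj (σ (v 1)) - conj (σ (v 0)) * σ (v 1)) ^ 2 := by
    rw [Matrix.det_fin_two]
    simp only [Algebra.embeddingsMatrixReindex, Matrix.reindex_apply, Matrix.submatrix_apply,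
      Equiv.refl_symm, Equiv.refl_apply, Equiv.symm_symm, Algebra.embeddingsMatrix_apply]
    have hne : e 0 ≠ e 1 := fun h => by simpa using e.injective h
    rcases algHom_eq_or_eq_conjugate hK σ (e 0) with h0 | h0 <;>
      rcases algHom_eq_or_eq_conjugate hK σ (e 1) with h1 | h1
    · exact absurd (AlgHom.coe_ringHom_injective (h0.trans h1.symm)) hne
    · have e0 : ∀ x, e 0 x = σ x := fun x => by rw [← h0]; rfl
      have e1 : ∀ x, e 1 x = conj (σ x) := fun x => by
        rw [show conj (σ x) = ComplexEmbedding.conjugate σ x from rfl, ← h1]; rfl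
      simp only [e0, e1]
    · have e0 : ∀ x, e 0 x = conj (σ x) := fun x => by
        rw [show conj (σ x) = ComplexEmbedding.conjugate σ x from rfl, ← h0]; rfl
      have e1 : ∀ x, e 1 x = σ x := fun x => by rw [← h1]; rfl
      simp only [e0, e1]; ring
    · exact absurd (AlgHom.coe_ringHom_injective (h0.trans h1.symm)) hne
  rw [hdet] at hE
  rw [← hE]
  have hPd : ((P.det : ℚ) : ℂ) ^ 2 = ((Ideal.absNorm 𝔟 : ℕ) : ℂ) ^ 2 := by
    rw [← hPdet]
    have : ((P.det.natAbs : ℕ) : ℂ) ^ 2 = ((P.det : ℤ) : ℂ) ^ 2 := by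
      rw [← Int.cast_natCast, ← Int.cast_pow, Int.natAbs_sq, Int.cast_pow]
    rw [this]; norm_cast
  simp only [eq_ratCast, Rat.cast_intCast] at hPd ⊢
  rw [hPd]; ring

/-! ### The Gram matrix -/

/-- **The Gram matrix of an ideal lattice.**  For an imaginary quadratic field `K` (`[K:ℚ] = 2`,
totally complex), a complex embedding `σ` and a nonzero ideal `𝔟`, there are a `ℤ`-basis `b` of `𝔟`
and `B ∈ M₂(ℤ)` — the Gram matrix of `Q_𝔟(x) = N(x)/N𝔟` — with
`B_{ij} = (σbᵢ \overline{σbⱼ} + \overline{σbᵢ} σbⱼ)/N𝔟`, `B` symmetric with even diagonal,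
`det B = |d_K|`, and `B` positive definite.  (Hecke 1926 §2; Cox Thm. 7.7: the norm form of an ideal
class is a primitive positive definite form of discriminant `d_K`.) -/
theorem exists_gram (hK : finrank ℚ K = 2) [IsTotallyComplex K] (σ : K →+* ℂ)
    {𝔟 : Ideal (𝓞 K)} (h𝔟 : 𝔟 ≠ ⊥) :
    ∃ (b : Basis (Fin 2) ℤ 𝔟) (B : Matrix (Fin 2) (Fin 2) ℤ),
      (∀ i j, ((B i j : ℤ) : ℂ) * ((Ideal.absNorm 𝔟 : ℕ) : ℂ) =
        σ ((b i : 𝓞 K) : K) * conj (σ ((b j : 𝓞 K) : K)) + conj (σ ((b i : 𝓞 K) : K)) * σ ((b j : 𝓞 K) : K)) ∧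
      B.IsSymm ∧ Even (B 0 0) ∧ Even (B 1 1) ∧ B.det = ((discr K).natAbs : ℤ) ∧
      (B.map (Int.cast : ℤ → ℝ)).PosDef := by
  classical
  obtain ⟨b, -⟩ := exists_basis_fin_two hK h𝔟
  have hN0 : Ideal.absNorm 𝔟 ≠ 0 := by
    rw [Ne, Ideal.absNorm_eq_zero_iff]; exact h𝔟
  have hNpos : (0 : ℝ) < (Ideal.absNorm 𝔟 : ℕ) := by exact_mod_cast Nat.pos_of_ne_zero hN0
  -- the integral quadratic form `q(x) = |N x| / N𝔟` on `𝔟`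
  set q : 𝔟 → ℕ := fun x => (Algebra.norm ℤ (x : 𝓞 K)).natAbs / Ideal.absNorm 𝔟 with hq
  have hq_mul : ∀ x : 𝔟, (q x : ℝ) * (Ideal.absNorm 𝔟 : ℕ) = ‖σ ((x : 𝓞 K) : K)‖ ^ 2 := by
    intro x
    rw [normSq_embedding_eq hK σ, hq]
    have hdvd := absNorm_dvd_natAbs_norm x.2
    exact_mod_cast Nat.div_mul_cancel hdvd
  set u : Fin 2 → ℂ := fun i => σ ((b i : 𝓞 K) : K) with hu
  set B : Matrix (Fin 2) (Fin 2) ℤ := fun i j => (q (b i + b j) : ℤ) - q (b i) - q (b j) with hB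
  -- the entry formula
  have hentry : ∀ i j, ((B i j : ℤ) : ℂ) * ((Ideal.absNorm 𝔟 : ℕ) : ℂ) = u i * conj (u j) + conj (u i) * u j := by
    intro i j
    have h1 := hq_mul (b i + b j)
    have h2 := hq_mul (b i)
    have h3 := hq_mul (b j)
    have hadd : σ (((b i + b j : 𝔟) : 𝓞 K) : K) = u i + u j := by
      simp [hu, Submodule.coe_add, map_add]
    rw [hadd] at h1
    rw [← normSq_add_sub (u i) (u j), ← h1, ← h2, ← h3]
    simp only [hB]
    push_cast
    ring
  -- entries over `ℝ`: `B_{ij} N𝔟 = 2 Re(uᵢ ūⱼ)`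
  have hentryR : ∀ i j, ((B i j : ℤ) : ℝ) * (Ideal.absNorm 𝔟 : ℕ) = 2 * (u i * conj (u j)).re := by
    intro i j
    have h := hentry i j
    have h2 : conj (u i) * u j = conj (u i * conj (u j)) := by rw [map_mul, Complex.conj_conj]
    rw [h2, Complex.add_conj] at h
    exact_mod_cast h
  have hsymm : B.IsSymm := by
    ext i j; simp only [Matrix.transpose_apply, hB]; rw [add_comm (b j) (b i)]; ring
  have hdiag : ∀ i, B i i = 2 * q (b i) := by
    intro i
    have h : ((B i i : ℤ) : ℝ) * (Ideal.absNorm 𝔟 : ℕ) = ((2 * q (b i) : ℤ) : ℝ) * (Ideal.absNorm 𝔟 : ℕ) := by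
      rw [hentryR]
      push_cast
      rw [mul_assoc, hq_mul (b i), hu]
      simp only
      rw [Complex.mul_conj, ← Complex.sq_norm]
      norm_cast
    have h' : ((B i i : ℤ) : ℝ) = ((2 * q (b i) : ℤ) : ℝ) :=
      mul_right_cancel₀ hNpos.ne' h
    exact_mod_cast h'
  -- the determinant
  have hIm : (u 0 * conj (u 1) - conj (u 0) * u 1) ^ 2 =
      ((discr K : ℤ) : ℂ) * ((Ideal.absNorm 𝔟 : ℕ) : ℂ) ^ 2 := det_embeddings_sq hK σ b
  have hdetC : ((B.det : ℤ) : ℂ) * ((Ideal.absNorm 𝔟 : ℕ) : ℂ) ^ 2 =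
      -((discr K : ℤ) : ℂ) * ((Ideal.absNorm 𝔟 : ℕ) : ℂ) ^ 2 := by
    rw [Matrix.det_fin_two]
    push_cast
    have e00 := hentry 0 0
    have e01 := hentry 0 1
    have e10 := hentry 1 0
    have e11 := hentry 1 1
    linear_combination ((B 1 1 : ℤ) : ℂ) * ((Ideal.absNorm 𝔟 : ℕ) : ℂ) * e00 +
      (u 0 * conj (u 0) + conj (u 0) * u 0) * e11 - ((B 1 0 : ℤ) : ℂ) * ((Ideal.absNorm 𝔟 : ℕ) : ℂ) * e01 -
      (u 0 * conj (u 1) + conj (u 0) * u 1) * e10 - hIm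
  -- `d_K < 0`: `(u₀ū₁ - ū₀u₁)² = d_K N𝔟²` is the square of a purely imaginary number
  have hz : u 0 * conj (u 1) - conj (u 0) * u 1 = ((2 * (u 0 * conj (u 1)).im : ℝ) : ℂ) * I := by
    rw [show conj (u 0) * u 1 = conj (u 0 * conj (u 1)) by rw [map_mul, Complex.conj_conj],
      Complex.sub_conj]
  have hdK : discr K < 0 := by
    have hne : discr K ≠ 0 := NumberField.discr_ne_zero K
    have hre : ((discr K : ℤ) : ℝ) * ((Ideal.absNorm 𝔟 : ℕ) : ℝ) ^ 2 = -(2 * (u 0 * conj (u 1)).im) ^ 2 := by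
      have h := hIm
      rw [hz, mul_pow, Complex.I_sq] at h
      have h' := congrArg Complex.re h
      simp only [Complex.mul_re, Complex.neg_re, Complex.one_re, Complex.ofReal_re, Complex.ofReal_im,
        Complex.neg_im, Complex.one_im, sub_zero, zero_mul, ← Complex.ofReal_pow, ← Complex.ofReal_intCast,
        ← Complex.ofReal_natCast, ← Complex.ofReal_mul] at h'
      linarith [h']
    have hle : ((discr K : ℤ) : ℝ) * ((Ideal.absNorm 𝔟 : ℕ) : ℝ) ^ 2 ≤ 0 := by
      rw [hre]; nlinarith [sq_nonneg (2 * (u 0 * conj (u 1)).im)]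
    have hN2 : (0 : ℝ) < ((Ideal.absNorm 𝔟 : ℕ) : ℝ) ^ 2 := by positivity
    have hd0 : ((discr K : ℤ) : ℝ) ≤ 0 := by
      by_contra hcon
      push Not at hcon
      have := mul_pos hcon hN2
      linarith
    have : (discr K : ℤ) ≤ 0 := by exact_mod_cast hd0
    omega
  have hdet : B.det = ((discr K).natAbs : ℤ) := by
    have h2 : ((Ideal.absNorm 𝔟 : ℕ) : ℂ) ^ 2 ≠ 0 := pow_ne_zero 2 (by exact_mod_cast hN0)
    have h : ((B.det : ℤ) : ℂ) = -((discr K : ℤ) : ℂ) := mul_right_cancel₀ h2 (by rw [hdetC])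
    have h' : B.det = -discr K := by exact_mod_cast h
    rw [h', Int.natCast_natAbs, abs_of_neg hdK]
  -- positive definiteness over `ℝ`
  have hpos : (B.map (Int.cast : ℤ → ℝ)).PosDef := by
    rw [Matrix.posDef_iff_dotProduct_mulVec]
    refine ⟨?_, fun x hx => ?_⟩
    · -- symmetric real matrix
      have : (B.map (Int.cast : ℤ → ℝ)).IsSymm := hsymm.map _
      exact this
    · -- `ᵗx B x · N𝔟 = 2 |x₀ u₀ + x₁ u₁|²`
      set S : ℂ := (x 0 : ℂ) * u 0 + (x 1 : ℂ) * u 1 with hS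
      have hconjS : conj S = (x 0 : ℂ) * conj (u 0) + (x 1 : ℂ) * conj (u 1) := by
        rw [hS, map_add, map_mul, map_mul, Complex.conj_ofReal, Complex.conj_ofReal]
      have hC : (((star x ⬝ᵥ (B.map (Int.cast : ℤ → ℝ) *ᵥ x)) * (Ideal.absNorm 𝔟 : ℕ) : ℝ) : ℂ) =
          2 * (S * conj S) := by
        have e00 := hentry 0 0
        have e01 := hentry 0 1
        have e10 := hentry 1 0
        have e11 := hentry 1 1
        simp only [star_trivial, dotProduct, Matrix.mulVec, Fin.sum_univ_two, Matrix.map_apply]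
        push_cast
        rw [hconjS, hS]
        linear_combination (↑(x 0) : ℂ) ^ 2 * e00 + (↑(x 0) : ℂ) * (↑(x 1) : ℂ) * e01 +
          (↑(x 1) : ℂ) * (↑(x 0) : ℂ) * e10 + (↑(x 1) : ℂ) ^ 2 * e11
      have hform : (star x ⬝ᵥ (B.map (Int.cast : ℤ → ℝ) *ᵥ x)) * (Ideal.absNorm 𝔟 : ℕ) = 2 * ‖S‖ ^ 2 := by
        have h2 : (2 : ℂ) * (S * conj S) = ((2 * ‖S‖ ^ 2 : ℝ) : ℂ) := by
          rw [Complex.mul_conj, Complex.normSq_eq_norm_sq]; push_cast; ring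
        rw [h2] at hC
        exact_mod_cast hC
      have hnn : 0 ≤ star x ⬝ᵥ (B.map (Int.cast : ℤ → ℝ) *ᵥ x) := by
        by_contra hneg
        push Not at hneg
        have h1 : (star x ⬝ᵥ (B.map (Int.cast : ℤ → ℝ) *ᵥ x)) * (Ideal.absNorm 𝔟 : ℕ) < 0 :=
          mul_neg_of_neg_of_pos hneg hNpos
        rw [hform] at h1
        nlinarith [sq_nonneg ‖S‖]
      rcases hnn.lt_or_eq with hlt | heq
      · exact hlt
      · exfalso
        -- `x₀ u₀ + x₁ u₁ = 0` with `x ≠ 0` forces `u₀ū₁` real, contradicting `d_K ≠ 0`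
        have h0 : ‖S‖ ^ 2 = 0 := by
          have := hform; rw [← heq, zero_mul] at this; linarith
        have hsum : (x 0 : ℂ) * u 0 + (x 1 : ℂ) * u 1 = 0 := by
          rw [sq_eq_zero_iff, norm_eq_zero] at h0; exact h0
        have him0 : (u 0 * conj (u 1)).im = 0 := by
          -- multiply `x₀ u₀ = -x₁ u₁` by `ū₁`: `x₀ u₀ū₁ = -x₁ |u₁|²` is real; if `x₀ = 0` then `x₁ u₁ = 0`
          by_cases hx0 : x 0 = 0
          · have hx1 : x 1 ≠ 0 := by
              intro h1; apply hx; funext i; fin_cases i <;> simp [hx0, h1]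
            have hu1 : u 1 = 0 := by
              rw [hx0] at hsum; simp only [Complex.ofReal_zero, zero_mul, zero_add, mul_eq_zero,
                Complex.ofReal_eq_zero] at hsum
              exact hsum.resolve_left hx1
            simp [hu1]
          · have h1 : (x 0 : ℂ) * (u 0 * conj (u 1)) = -((x 1 : ℂ) * (u 1 * conj (u 1))) := by
              linear_combination conj (u 1) * hsum
            have h2 := congrArg Complex.im h1
            rw [Complex.im_ofReal_mul, Complex.neg_im, Complex.im_ofReal_mul, Complex.mul_conj,
              Complex.ofReal_im, mul_zero, neg_zero] at h2
            exact (mul_eq_zero.mp h2).resolve_left hx0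
        have hzero : ((discr K : ℤ) : ℂ) * ((Ideal.absNorm 𝔟 : ℕ) : ℂ) ^ 2 = 0 := by
          rw [← hIm, hz, him0]; simp
        have hne : discr K ≠ 0 := NumberField.discr_ne_zero K
        rcases mul_eq_zero.mp hzero with h | h
        · exact hne (by exact_mod_cast h)
        · exact hN0 (by exact_mod_cast (pow_eq_zero_iff two_ne_zero).mp h)
  exact ⟨b, B, hentry, hsymm, ⟨q (b 0), by rw [hdiag]; ring⟩, ⟨q (b 1), by rw [hdiag]; ring⟩, hdet, hpos⟩

end Summit.BirchSwinnertonDyer.BirchSwinnertonDyer.Theorems.HeckeTheta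

end
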